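import Summits.AtomisticToContinuum.FouriersLaw.Theorems.VanishingNoiseTransferNoiseLocalityStubFlipDissipationBound

/-!
# Stub `stub_noisyPositive` of crux `NoiseLocality`, part 2: an `L²(e^{-H/T})` function annihilated
by the two Ornstein–Uhlenbeck taps does not depend on the contact momenta

Helper file `--supports stmt-AtomisticToContinuum-11975` (crux `NoiseLocality`, route
`VanishingNoiseTransfer`, line `relative-flip-energy-transfer`, stub `stub_noisyPositive`).

For the pinned anharmonic chain (`ω₂ > 0`, `lam, β ≥ 0`, `N ≥ 2`, `T > 0`), the Gibbs density
`ρ = e^{-H/T}`, the bath operator `B = (T∂²_{p_0} - p_0∂_{p_0}) + (T∂²_{p_{N-1}} - p_{N-1}∂_{p_{N-1}})` and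
a CLASSICAL solution `k ∈ C²` of `B k = 0` with `∫ k² ρ < ∞`:

* `bath_energy_estimate` — the Caccioppoli inequality with the energy cutoffs `χ_R = χ(H/R)`:
  `∫ (∂_{p_0}k)² χ_R² ρ + ∫ (∂_{p_{N-1}}k)² χ_R² ρ ≤ 32 M² R⁻¹ ∫ k² ρ` (`M = sup |χ'|`): multiply
  `B k = 0` by `k χ_R² ρ`, integrate, use the symmetry of each tap and its carré du champ
  (`integral_bath_mul_mul_gibbsDensity`, `integral_bath_mul_gibbsDensity_eq_neg`), keep half of the
  gradient term when completing the square, and `(∂_{p_b}χ_R)² ≤ 4M²/R`;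
* `partialP_bath_eq_zero_of_bath_eq_zero` — hence `∂_{p_0} k ≡ 0 ≡ ∂_{p_{N-1}} k` (`R → ∞`; the
  cutoffs increase to `1`, and a continuous non-negative integrand with a non-zero value has positive
  integral).

This is the uniqueness-of-the-momentum-profile input of the non-existence of flip-invariant response
densities (`…StubNoisyPositiveAux3`). No definitions.
-/

noncomputable section

open MeasureTheory Filter Topology Set Function
open scoped ContDiff

namespace Summit.AtomisticToContinuum.FouriersLaw.Theorems.NoiseLocality.StubNoisyPositive

open Literature.MathematicalPhysics.KineticTheory.HeatConduction
open Summit.AtomisticToContinuum.FouriersLaw.Theorems.OddSectorIrreversibility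
open Summit.AtomisticToContinuum.FouriersLaw.Theorems.SubdiffusiveBondHeat

variable {N : ℕ}

section Pinned

variable {ω₂ lam β γ : ℝ} (hω : 0 < ω₂) (hl : 0 ≤ lam) (hβ : 0 ≤ β) (hN : 2 ≤ N) {T : ℝ} (hT : 0 < T)
include hω hl hβ hN hT

/-- **Caccioppoli inequality for the two taps.** For `k ∈ C²` with
`(T∂²_{p_0}k - p_0∂_{p_0}k) + (T∂²_{p_{N-1}}k - p_{N-1}∂_{p_{N-1}}k) = 0` pointwise and `∫ k² e^{-H/T} < ∞`,
and the energy cutoff `χ_R = χ(H/R)` (`R > 0`, `M = sup|χ'|`):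
`∫ (∂_{p_0}k)² χ_R² e^{-H/T} + ∫ (∂_{p_{N-1}}k)² χ_R² e^{-H/T} ≤ 32 M² R⁻¹ ∫ k² e^{-H/T}`. [folklore] -/
theorem bath_energy_estimate {k : PhaseSpace N → ℝ} (hk : ContDiff ℝ 2 k)
    (hk2 : Integrable (fun x => k x ^ 2 * (pinnedChain ω₂ lam β γ).gibbsDensity N T x))
    (hbath : ∀ x : PhaseSpace N,
      (T * partialP ⟨0, by omega⟩ (partialP ⟨0, by omega⟩ k) x - x.2 ⟨0, by omega⟩ * partialP ⟨0, by omega⟩ k x) +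
        (T * partialP ⟨N - 1, by omega⟩ (partialP ⟨N - 1, by omega⟩ k) x -
          x.2 ⟨N - 1, by omega⟩ * partialP ⟨N - 1, by omega⟩ k x) = 0)
    {M : ℝ} (hM : ∀ u, |deriv smoothCutoff u| ≤ M) {R : ℝ} (hR : 0 < R) :
    (∫ x, (partialP ⟨0, by omega⟩ k x) ^ 2 *
        (smoothCutoff ((pinnedChain ω₂ lam β γ).hamiltonian N x / R)) ^ 2 *
          (pinnedChain ω₂ lam β γ).gibbsDensity N T x) +
      ∫ x, (partialP ⟨N - 1, by omega⟩ k x) ^ 2 *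
        (smoothCutoff ((pinnedChain ω₂ lam β γ).hamiltonian N x / R)) ^ 2 *
          (pinnedChain ω₂ lam β γ).gibbsDensity N T x ≤
      32 * M ^ 2 / R * ∫ x, k x ^ 2 * (pinnedChain ω₂ lam β γ).gibbsDensity N T x := by
  set P := pinnedChain ω₂ lam β γ with hP
  have hU : ContDiff ℝ ∞ P.U := pinnedChain_contDiff_U ω₂ lam β γ
  have hV : ContDiff ℝ ∞ P.V := pinnedChain_contDiff_V ω₂ lam β γ
  have hU1 : ContDiff ℝ 1 P.U := pinnedChain_contDiff_U ω₂ lam β γ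
  have hV1 : ContDiff ℝ 1 P.V := pinnedChain_contDiff_V ω₂ lam β γ
  set ρ := P.gibbsDensity N T with hρ
  set χ : PhaseSpace N → ℝ := fun x => smoothCutoff (P.hamiltonian N x / R) with hχ
  have hχs : ContDiff ℝ ∞ χ := contDiff_energyCutoff (ω₂ := ω₂) (lam := lam) (β := β) γ N R
  have hχc : HasCompactSupport χ := hasCompactSupport_energyCutoff hω hl hβ γ N hR
  have hχd : Differentiable ℝ χ := hχs.differentiable (by simp)
  have hχ2c : HasCompactSupport (fun x => χ x ^ 2) := by
    have h := hχc.mul_left (f := χ)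
    have e : (fun x => χ x ^ 2) = χ * χ := by
      funext x; simp only [Pi.mul_apply, sq]
    rw [e]
    exact h
  have hχχd : Differentiable ℝ (fun y => χ y * χ y) := hχd.mul hχd
  have hkd : Differentiable ℝ k := hk.differentiable two_ne_zero
  have hρc : Continuous ρ := P.continuous_gibbsDensity hU.continuous hV.continuous N T
  have hk1 : ∀ i, ContDiff ℝ 1 (partialP i k) := fun i => contDiff_partialP hk (by norm_num) i
  -- the test function `F = k χ²`
  set F : PhaseSpace N → ℝ := fun x => k x * (χ x * χ x) with hF
  have hχχs : ContDiff ℝ ∞ (fun x => χ x * χ x) := hχs.mul hχs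
  have hFs : ContDiff ℝ 2 F := (hk.of_le le_rfl).mul (hχχs.of_le (by norm_cast))
  have hFc : HasCompactSupport F := (hχc.mul_left (f := χ)).mul_left
  have hFd : Differentiable ℝ F := hFs.differentiable two_ne_zero
  -- (Y) each tap: `∫ (B_i k) k χ² ρ ≤ -(T/2) ∫ χ² (∂_i k)² ρ + 2T (4M²/R) ∫ k² ρ`
  have hY : ∀ i : Fin N, ∫ x, (T * partialP i (partialP i k) x - x.2 i * partialP i k x) *
      (k x * (χ x * χ x)) * ρ x ≤
      -(T / 2) * (∫ x, (partialP i k x) ^ 2 * χ x ^ 2 * ρ x) +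
        2 * T * (4 * M ^ 2 / R) * ∫ x, k x ^ 2 * ρ x := by
    intro i
    -- symmetry, then carré du champ
    have hsym := integral_bath_mul_mul_gibbsDensity P hU1 hV1 N T hT.ne' hFs hFc hk i
    have hcar := integral_bath_mul_gibbsDensity_eq_neg P hU1 hV1 N hT.ne' hFs hFc (hk.of_le (by norm_num)) i
    have e0 : ∫ x, (T * partialP i (partialP i k) x - x.2 i * partialP i k x) * (k x * (χ x * χ x)) * ρ x =
        ∫ x, F x * (T * partialP i (partialP i k) x - x.2 i * partialP i k x) * ρ x :=
      integral_congr_ae (Eventually.of_forall fun x => by simp only [hF]; ring)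
    rw [e0, ← hsym, hcar]
    -- pointwise: `-T ∂F ∂k ≤ -(T/2) χ²(∂k)² + 2T k² (∂χ)²`, and `(∂χ)² ≤ 4M²/R`
    have hpt : ∀ x, -T * (partialP i F x * partialP i k x * ρ x) ≤
        -(T / 2) * ((partialP i k x) ^ 2 * χ x ^ 2 * ρ x) + 2 * T * (4 * M ^ 2 / R) * (k x ^ 2 * ρ x) := by
      intro x
      have hρ0 : 0 ≤ ρ x := (P.gibbsDensity_pos N T x).le
      have hdF : partialP i F x = k x * (2 * χ x * partialP i χ x) + χ x * χ x * partialP i k x := by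
        have hp := OddSectorIrreversibility.partialP_mul hkd hχχd i x
        have hp2 := OddSectorIrreversibility.partialP_mul hχd hχd i x
        simp only [hF] at hp ⊢
        rw [hp]
        simp only [hχ] at hp2 ⊢
        rw [hp2]
        ring
      have hsq := sq_partialP_energyCutoff_le (lam := lam) (β := β) hl hβ hω.le γ N hR hM i x
      have h1 : -T * (partialP i F x * partialP i k x) ≤
          -(T / 2) * ((partialP i k x) ^ 2 * χ x ^ 2) + 2 * T * (k x ^ 2 * (partialP i χ x) ^ 2) := by
        rw [hdF]
        nlinarith [sq_nonneg (χ x * partialP i k x + 2 * k x * partialP i χ x), hT]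
      have h2 : 2 * T * (k x ^ 2 * (partialP i χ x) ^ 2) ≤ 2 * T * (4 * M ^ 2 / R) * k x ^ 2 := by
        have : k x ^ 2 * (partialP i χ x) ^ 2 ≤ k x ^ 2 * (4 * M ^ 2 / R) :=
          mul_le_mul_of_nonneg_left hsq (sq_nonneg _)
        nlinarith
      have := mul_le_mul_of_nonneg_right (h1.trans (by linarith [h2] :
        -(T / 2) * ((partialP i k x) ^ 2 * χ x ^ 2) + 2 * T * (k x ^ 2 * (partialP i χ x) ^ 2) ≤
          -(T / 2) * ((partialP i k x) ^ 2 * χ x ^ 2) + 2 * T * (4 * M ^ 2 / R) * k x ^ 2)) hρ0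
      nlinarith
    -- integrate the pointwise bound
    have hPkc : Continuous (partialP i k) := (hk1 i).continuous
    have hPFc : Continuous (partialP i F) := continuous_partialP hFs two_ne_zero i
    have hPFcs : HasCompactSupport (partialP i F) := hasCompactSupport_partialP hFd hFc i
    have iA : Integrable fun x => -T * (partialP i F x * partialP i k x * ρ x) :=
      (((hPFc.mul hPkc).mul hρc).integrable_of_hasCompactSupport (hPFcs.mul_right.mul_right)).const_mul _
    have iE : Integrable fun x => (partialP i k x) ^ 2 * χ x ^ 2 * ρ x := by
      refine Continuous.integrable_of_hasCompactSupport (((hPkc.pow 2).mul (hχs.continuous.pow 2)).mul hρc) ?_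
      exact (hχ2c.mul_left).mul_right
    have iB : Integrable fun x => -(T / 2) * ((partialP i k x) ^ 2 * χ x ^ 2 * ρ x) +
        2 * T * (4 * M ^ 2 / R) * (k x ^ 2 * ρ x) := (iE.const_mul _).add (hk2.const_mul _)
    calc -T * ∫ x, partialP i F x * partialP i k x * ρ x
        = ∫ x, -T * (partialP i F x * partialP i k x * ρ x) := (integral_const_mul _ _).symm
      _ ≤ ∫ x, (-(T / 2) * ((partialP i k x) ^ 2 * χ x ^ 2 * ρ x) +
            2 * T * (4 * M ^ 2 / R) * (k x ^ 2 * ρ x)) := integral_mono iA iB hpt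
      _ = -(T / 2) * (∫ x, (partialP i k x) ^ 2 * χ x ^ 2 * ρ x) +
            2 * T * (4 * M ^ 2 / R) * ∫ x, k x ^ 2 * ρ x := by
          rw [integral_add (iE.const_mul _) (hk2.const_mul _), integral_const_mul, integral_const_mul]
  -- assemble: the two taps sum to zero
  set b₀ : Fin N := ⟨0, by omega⟩ with hb₀
  set b₁ : Fin N := ⟨N - 1, by omega⟩ with hb₁
  have intS : ∀ i, Integrable (fun x => (T * partialP i (partialP i k) x - x.2 i * partialP i k x) *
      (k x * (χ x * χ x)) * ρ x) := by
    intro i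
    have hPkc : Continuous (partialP i k) := (hk1 i).continuous
    have hPPkc : Continuous (partialP i (partialP i k)) := continuous_partialP (hk1 i) one_ne_zero i
    refine Continuous.integrable_of_hasCompactSupport (by fun_prop) ?_
    exact (hFc.mul_left).mul_right
  have hsum : (∫ x, (T * partialP b₀ (partialP b₀ k) x - x.2 b₀ * partialP b₀ k x) * (k x * (χ x * χ x)) * ρ x) +
      ∫ x, (T * partialP b₁ (partialP b₁ k) x - x.2 b₁ * partialP b₁ k x) * (k x * (χ x * χ x)) * ρ x = 0 := by
    rw [← integral_add (intS b₀) (intS b₁)]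
    have e : (fun x => (T * partialP b₀ (partialP b₀ k) x - x.2 b₀ * partialP b₀ k x) * (k x * (χ x * χ x)) * ρ x +
        (T * partialP b₁ (partialP b₁ k) x - x.2 b₁ * partialP b₁ k x) * (k x * (χ x * χ x)) * ρ x) =
        fun _ => (0 : ℝ) := by
      funext x
      have h := hbath x
      calc (T * partialP b₀ (partialP b₀ k) x - x.2 b₀ * partialP b₀ k x) * (k x * (χ x * χ x)) * ρ x +
          (T * partialP b₁ (partialP b₁ k) x - x.2 b₁ * partialP b₁ k x) * (k x * (χ x * χ x)) * ρ x
          = ((T * partialP b₀ (partialP b₀ k) x - x.2 b₀ * partialP b₀ k x) +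
              (T * partialP b₁ (partialP b₁ k) x - x.2 b₁ * partialP b₁ k x)) * (k x * (χ x * χ x)) * ρ x := by
            ring
        _ = 0 := by rw [h]; ring
    rw [e, integral_zero]
  have h0 := hY b₀
  have h1 := hY b₁
  have hI0 : 0 ≤ ∫ x, k x ^ 2 * ρ x := integral_nonneg fun x => mul_nonneg (sq_nonneg _) (P.gibbsDensity_pos N T x).le
  have key : (T / 2) * ((∫ x, (partialP b₀ k x) ^ 2 * χ x ^ 2 * ρ x) +
      ∫ x, (partialP b₁ k x) ^ 2 * χ x ^ 2 * ρ x) ≤ (T / 2) * (32 * M ^ 2 / R * ∫ x, k x ^ 2 * ρ x) := by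
    have : (T / 2) * (32 * M ^ 2 / R * ∫ x, k x ^ 2 * ρ x) =
        2 * (2 * T * (4 * M ^ 2 / R) * ∫ x, k x ^ 2 * ρ x) := by ring
    rw [this]
    linarith
  exact le_of_mul_le_mul_left key (by positivity)

/-- **An `L²(e^{-H/T})` solution of `B k = 0` is independent of the contact momenta.** For `k ∈ C²`
with `(T∂²_{p_0}k - p_0∂_{p_0}k) + (T∂²_{p_{N-1}}k - p_{N-1}∂_{p_{N-1}}k) = 0` pointwise and
`∫ k² e^{-H/T} < ∞`: `∂_{p_0} k ≡ 0` and `∂_{p_{N-1}} k ≡ 0` (the kernel of the sum of the two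
Ornstein–Uhlenbeck taps in `L²` of the Gaussian consists of functions of the other variables).
Proof: `bath_energy_estimate` with `R → ∞`; the cutoffs `χ_R` increase with `R`, so a non-zero value
of the continuous `∂_{p_b}k` would keep `∫ (∂_{p_b}k)² χ_R² e^{-H/T}` bounded below. [folklore] -/
theorem partialP_bath_eq_zero_of_bath_eq_zero {k : PhaseSpace N → ℝ} (hk : ContDiff ℝ 2 k)
    (hk2 : Integrable (fun x => k x ^ 2 * (pinnedChain ω₂ lam β γ).gibbsDensity N T x))
    (hbath : ∀ x : PhaseSpace N,
      (T * partialP ⟨0, by omega⟩ (partialP ⟨0, by omega⟩ k) x - x.2 ⟨0, by omega⟩ * partialP ⟨0, by omega⟩ k x) +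
        (T * partialP ⟨N - 1, by omega⟩ (partialP ⟨N - 1, by omega⟩ k) x -
          x.2 ⟨N - 1, by omega⟩ * partialP ⟨N - 1, by omega⟩ k x) = 0)
    (b : Fin N) (hb : b.val = 0 ∨ b.val = N - 1) (x : PhaseSpace N) : partialP b k x = 0 := by
  set P := pinnedChain ω₂ lam β γ with hP
  haveI := isAddHaarMeasure_volume_phaseSpace N
  have hU : ContDiff ℝ ∞ P.U := pinnedChain_contDiff_U ω₂ lam β γ
  have hV : ContDiff ℝ ∞ P.V := pinnedChain_contDiff_V ω₂ lam β γ
  set ρ := P.gibbsDensity N T with hρ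
  have hρc : Continuous ρ := P.continuous_gibbsDensity hU.continuous hV.continuous N T
  have hHc : Continuous (P.hamiltonian N) := pinnedChain_continuous_hamiltonian ω₂ lam β γ N
  obtain ⟨M, -, hM⟩ := exists_bound_deriv_smoothCutoff
  set I : ℝ := ∫ x, k x ^ 2 * ρ x with hI
  have hPkc : Continuous (partialP b k) := continuous_partialP hk two_ne_zero b
  -- the cut-off tap energies of the bath `b`
  set f : ℝ → PhaseSpace N → ℝ := fun R y =>
    (partialP b k y) ^ 2 * (smoothCutoff (P.hamiltonian N y / R)) ^ 2 * ρ y with hf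
  have hfc : ∀ R, Continuous (f R) := fun R =>
    ((hPkc.pow 2).mul (((contDiff_smoothCutoff (n := ⊤)).continuous.comp (hHc.div_const R)).pow 2)).mul hρc
  have hfcs : ∀ R, 0 < R → HasCompactSupport (f R) := by
    intro R hR
    have h := hasCompactSupport_energyCutoff hω hl hβ γ N hR
    have h2 : HasCompactSupport (fun y : PhaseSpace N => (smoothCutoff (P.hamiltonian N y / R)) ^ 2) := by
      have h' := h.mul_left (f := fun y : PhaseSpace N => smoothCutoff (P.hamiltonian N y / R))
      have e : (fun y : PhaseSpace N => (smoothCutoff (P.hamiltonian N y / R)) ^ 2) =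
          (fun y : PhaseSpace N => smoothCutoff (P.hamiltonian N y / R)) *
            fun y : PhaseSpace N => smoothCutoff (P.hamiltonian N y / R) := by
        funext y; simp only [Pi.mul_apply, sq]
      rw [e]
      exact h'
    exact (h2.mul_left).mul_right
  have hf0 : ∀ R y, 0 ≤ f R y := fun R y =>
    mul_nonneg (mul_nonneg (sq_nonneg _) (sq_nonneg _)) (P.gibbsDensity_pos N T y).le
  -- the Caccioppoli bound for the bath `b`
  have hbound : ∀ R, 0 < R → ∫ y, f R y ≤ 32 * M ^ 2 / R * I := by
    intro R hR
    have h := bath_energy_estimate hω hl hβ hN hT hk hk2 hbath hM hR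
    have hn0 : 0 ≤ ∫ y, (partialP ⟨0, by omega⟩ k y) ^ 2 * (smoothCutoff (P.hamiltonian N y / R)) ^ 2 * ρ y :=
      integral_nonneg fun y => mul_nonneg (mul_nonneg (sq_nonneg _) (sq_nonneg _)) (P.gibbsDensity_pos N T y).le
    have hn1 : 0 ≤ ∫ y, (partialP ⟨N - 1, by omega⟩ k y) ^ 2 * (smoothCutoff (P.hamiltonian N y / R)) ^ 2 * ρ y :=
      integral_nonneg fun y => mul_nonneg (mul_nonneg (sq_nonneg _) (sq_nonneg _)) (P.gibbsDensity_pos N T y).le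
    rcases hb with hb | hb
    · have e : b = ⟨0, by omega⟩ := Fin.ext hb
      rw [hf]
      simp only [e]
      linarith
    · have e : b = ⟨N - 1, by omega⟩ := Fin.ext hb
      rw [hf]
      simp only [e]
      linarith
  -- monotonicity of the cutoffs in `R`
  have hmono : ∀ R₀ R, 0 < R₀ → R₀ ≤ R → ∀ y, f R₀ y ≤ f R y := by
    intro R₀ R hR₀ hle y
    have hH0 : 0 ≤ P.hamiltonian N y := pinnedChain_hamiltonian_nonneg hω.le hl hβ γ N y
    have hdiv : P.hamiltonian N y / R ≤ P.hamiltonian N y / R₀ :=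
      div_le_div_of_nonneg_left hH0 hR₀ hle
    have hχ : smoothCutoff (P.hamiltonian N y / R₀) ≤ smoothCutoff (P.hamiltonian N y / R) :=
      antitone_smoothCutoff hdiv
    have hχ0 : 0 ≤ smoothCutoff (P.hamiltonian N y / R₀) := smoothCutoff_nonneg _
    simp only [hf]
    have hρ0 : 0 ≤ ρ y := (P.gibbsDensity_pos N T y).le
    have hsq : (smoothCutoff (P.hamiltonian N y / R₀)) ^ 2 ≤ (smoothCutoff (P.hamiltonian N y / R)) ^ 2 :=
      pow_le_pow_left₀ hχ0 hχ 2
    gcongr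
  -- suppose `∂_{p_b} k x ≠ 0`: the cut-off energies stay bounded below
  by_contra hx
  set R₀ : ℝ := max (P.hamiltonian N x) 1 with hR₀
  have hR₀pos : 0 < R₀ := lt_of_lt_of_le one_pos (le_max_right _ _)
  have hχx : smoothCutoff (P.hamiltonian N x / R₀) = 1 :=
    smoothCutoff_of_le_one ((div_le_one hR₀pos).2 (le_max_left _ _))
  have hfx : f R₀ x ≠ 0 := by
    simp only [hf, hχx, one_pow, mul_one]
    exact mul_ne_zero (pow_ne_zero 2 hx) (P.gibbsDensity_pos N T x).ne'
  have hc₀ : 0 < ∫ y, f R₀ y :=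
    (hfc R₀).integral_pos_of_hasCompactSupport_nonneg_nonzero (hfcs R₀ hR₀pos) (hf0 R₀) hfx
  -- but they are `O(1/R)`
  have hlim : Tendsto (fun R : ℝ => 32 * M ^ 2 / R * I) atTop (𝓝 0) := by
    have h : Tendsto (fun R : ℝ => 32 * M ^ 2 * I / R) atTop (𝓝 0) :=
      tendsto_const_nhds.div_atTop tendsto_id
    refine h.congr fun R => by ring
  obtain ⟨R, hR1, hR2⟩ := ((hlim.eventually (gt_mem_nhds hc₀)).and (eventually_ge_atTop R₀)).exists
  have hRpos : 0 < R := lt_of_lt_of_le hR₀pos hR2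
  have h1 : ∫ y, f R₀ y ≤ ∫ y, f R y :=
    integral_mono ((hfc R₀).integrable_of_hasCompactSupport (hfcs R₀ hR₀pos))
      ((hfc R).integrable_of_hasCompactSupport (hfcs R hRpos)) (hmono R₀ R hR₀pos hR2)
  have h2 := hbound R hRpos
  linarith

end Pinned

/-! ### Registered helper sub-goal (stub form, one line) -/

/-- Registered helper sub-goal `helper_noisyPositiveBathKernel` of stub `stub_noisyPositive`
(= `partialP_bath_eq_zero_of_bath_eq_zero` in stub form, the two bath sites `a = 0`, `b = N - 1` passed by
value): an `L²(e^{-H/T})` classical solution of `B k = 0` for the two Ornstein–Uhlenbeck taps does not depend on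
the contact momenta. -/
theorem helper_noisyPositiveBathKernel : ∀ ω₂ lam β γ : ℝ, 0 < ω₂ → 0 ≤ lam → 0 ≤ β → ∀ (N : ℕ), 2 ≤ N → ∀ (T : ℝ), 0 < T → ∀ (a b : Fin N), a.val = 0 → b.val = N - 1 → ∀ k : Literature.MathematicalPhysics.KineticTheory.HeatConduction.PhaseSpace N → ℝ, ContDiff ℝ 2 k → MeasureTheory.Integrable (fun x : Literature.MathematicalPhysics.KineticTheory.HeatConduction.PhaseSpace N => k x ^ 2 * (Literature.MathematicalPhysics.KineticTheory.HeatConduction.pinnedChain ω₂ lam β γ).gibbsDensity N T x) → (∀ x : Literature.MathematicalPhysics.KineticTheory.HeatConduction.PhaseSpace N, (T * Literature.MathematicalPhysics.KineticTheory.HeatConduction.partialP a (Literature.MathematicalPhysics.KineticTheory.HeatConduction.partialP a k) x - x.2 a * Literature.MathematicalPhysics.KineticTheory.HeatConduction.partialP a k x) + (T * Literature.MathematicalPhysics.KineticTheory.HeatConduction.partialP b (Literature.MathematicalPhysics.KineticTheory.HeatConduction.partialP b k) x - x.2 b * Literature.MathematicalPhysics.KineticTheory.HeatConduction.partialP b k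 x) = 0) → ∀ x : Literature.MathematicalPhysics.KineticTheory.HeatConduction.PhaseSpace N, Literature.MathematicalPhysics.KineticTheory.HeatConduction.partialP a k x = 0 ∧ Literature.MathematicalPhysics.KineticTheory.HeatConduction.partialP b k x = 0 := by
  intro ω₂ lam β γ hω hl hβ N hN T hT a b ha hb k hk hk2 hbath x
  obtain ⟨av, hav⟩ := a
  obtain ⟨bv, hbv⟩ := b
  simp only at ha hb
  subst ha hb
  exact ⟨partialP_bath_eq_zero_of_bath_eq_zero hω hl hβ hN hT hk hk2 hbath _ (Or.inl rfl) x,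
    partialP_bath_eq_zero_of_bath_eq_zero hω hl hβ hN hT hk hk2 hbath _ (Or.inr rfl) x⟩

end Summit.AtomisticToContinuum.FouriersLaw.Theorems.NoiseLocality.StubNoisyPositive

end
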